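import Mathlib
import Summits.PneNP.PneNP.Theorems.ConvexRankGatesConvexGateBlindAffineRank
import Summits.PneNP.PneNP.Theorems.ConvexRankGatesConvexGateBlindAffinePencil
import Summits.PneNP.PneNP.Theorems.ConvexRankGatesConvexGateBlindAffinePencilSoc

/-!
# PneNP / ConvexRankGates — `ConvexGateBlind`: ONE `2 × 2` valid pencil excludes THREE bare cliques (uniqueness fails for SDP)

Helpers (`--supports stmt-PneNP-10680`), COLUMN-SPACE line (prover seat 2, session 24): the PSD side of the transposed
restricted class, NEGATIVE direction. `…AffineUnique.lean`: a valid affine inequality of the `k`-clique-free polytope (a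
`1 × 1` pencil) is violated by at most one bare `k`-clique, and `…AffinePencil.lean`: every single direction of a valid
`q × q` pencil refutes at most one bare clique. Here we show that this does NOT bound the number of cliques a pencil excludes
by its size: for ANY three pairwise edge-disjoint `k`-sets `T₁, T₂, T₃` (`k ≥ 3`) there is an affine `2 × 2` pencil
`H(x) = H₀ − ∑_e x_e H_e` — a single second-order-cone constraint — that is positive semidefinite at every `k`-clique-free
graph and NOT positive semidefinite at each of the three bare cliques `1_{E(T_j)}` (`soc_pencil_excludes_three`).
Construction (`K = C(k,2)`, `η = 1/(8K)`, `a₀ = η(K − ½)`): `H(x) = [[a + b₁, b₂],[b₂, a − b₁]]` with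
`a(x) = a₀ + |x| − η·x(E(T₁) ∪ E(T₂) ∪ E(T₃))`, `b₁(x) = x(E(T₁)) − x(E(T₂))`, `b₂(x) = x(E(T₃))` (directions `(1,0)`, `(−1,0)`,
`(0,1)` for the three cliques); a `k`-clique-free graph has at most `K − 1` edges inside each `T_j` (`one_le_cdist`), and then
`a ≥ 0`, `a² ≥ b₁² + b₂²` (`soc_core_ineq`), which is positive semidefiniteness (`soc_form_nonneg`, both in
`…AffinePencilSoc.lean`); at `1_{E(T_j)}`
the form is `−η/2 < 0` along `(0,1)`, `(1,0)`, `(1,−1)` respectively. So the exclusion number of a valid `q × q` pencil can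
exceed `q` (memo ANALYSIS-seat2-s24 §2: the same directions trick with `N` roots of unity excludes any edge-disjoint family,
e.g. the seven Fano lines of `K_7` at once); bounding it by `poly(q, m)` is the open sub-question `Q_psd`. [new]
-/

set_option linter.dupNamespace false

namespace Summit.PneNP.PneNP.Theorems

open Finset Real Filter Matrix Literature.Computability.Complexity
open Summit.PneNP.PneNP.Cruxes.ConvexGateBlind.StrictRankConicCover (Edge cdist)

noncomputable section

variable {m : ℕ}
/-! ## The pencil -/

/-- Edges inside `T`: `n_T(c) = ∑_e [c e]·[e ⊆ T]`. [folklore] -/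
theorem sum_ite_ite_eq_card_sub_cdist (T : Finset (Fin m)) (c : Edge m → Bool) :
    (∑ f, (if c f = true then (if cliqueVec T f = true then (1 : ℝ) else 0) else 0)) =
      ((cliqueEdges T).card : ℝ) - cdist T c := by
  rw [cdist_eq_card_sub_sum]; ring

/-- A `k`-clique-free graph has at most `#E(T) − 1` edges inside a `k`-set `T`. [folklore] -/
theorem sum_ite_ite_le_of_cliqueFree {k : ℕ} {T : Finset (Fin m)} (hT : T.card = k) {u : Edge m → Bool}
    (hu : cliqueFn m k u = false) :
    (∑ f, (if u f = true then (if cliqueVec T f = true then (1 : ℝ) else 0) else 0)) + 1 ≤ (cliqueEdges T).card := by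
  rw [sum_ite_ite_eq_card_sub_cdist]
  have := one_le_cdist hT hu
  linarith

/-- The bare clique `T` has all `#E(T)` of its edges inside `T` and none inside an edge-disjoint `T'`. [folklore] -/
theorem sum_ite_ite_cliqueVec_self (T : Finset (Fin m)) :
    (∑ f, (if cliqueVec T f = true then (if cliqueVec T f = true then (1 : ℝ) else 0) else 0)) = (cliqueEdges T).card := by
  classical
  rw [cliqueEdges, ← Finset.sum_boole]
  exact Finset.sum_congr rfl fun f _ => by by_cases h : cliqueVec T f = true <;> simp [h]

/-- A bare clique has no edge inside an edge-disjoint `k`-set. [folklore] -/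
theorem sum_ite_ite_cliqueVec_disjoint {T T' : Finset (Fin m)} (h : Disjoint (cliqueEdges T) (cliqueEdges T')) :
    (∑ f, (if cliqueVec T f = true then (if cliqueVec T' f = true then (1 : ℝ) else 0) else 0)) = 0 := by
  classical
  refine Finset.sum_eq_zero fun f _ => ?_
  by_cases h1 : cliqueVec T f = true
  · by_cases h2 : cliqueVec T' f = true
    · exfalso
      have hf1 : f ∈ cliqueEdges T := by rw [cliqueEdges, Finset.mem_filter]; exact ⟨Finset.mem_univ _, h1⟩
      have hf2 : f ∈ cliqueEdges T' := by rw [cliqueEdges, Finset.mem_filter]; exact ⟨Finset.mem_univ _, h2⟩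
      exact Finset.disjoint_left.1 h hf1 hf2
    · simp [h1, h2]
  · simp [h1]

/-- **One `2 × 2` valid pencil excludes three bare cliques.** For `3 ≤ k` and any three pairwise edge-disjoint `k`-sets
`T₁, T₂, T₃` there is an affine `2 × 2` pencil `H(x) = H₀ − ∑_e x_e H_e`, positive semidefinite at every `k`-clique-free
graph, that is NOT positive semidefinite at each of the bare cliques `1_{E(T₁)}`, `1_{E(T₂)}`, `1_{E(T₃)}`. [new] -/
theorem soc_pencil_excludes_three {k : ℕ} (hk : 3 ≤ k) {T₁ T₂ T₃ : Finset (Fin m)}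
    (hT₁ : T₁.card = k) (hT₂ : T₂.card = k) (hT₃ : T₃.card = k)
    (h12 : Disjoint (cliqueEdges T₁) (cliqueEdges T₂)) (h13 : Disjoint (cliqueEdges T₁) (cliqueEdges T₃))
    (h23 : Disjoint (cliqueEdges T₂) (cliqueEdges T₃)) :
    ∃ (H₀ : Matrix (Fin 2) (Fin 2) ℝ) (He : Edge m → Matrix (Fin 2) (Fin 2) ℝ),
      (∀ u : Edge m → Bool, cliqueFn m k u = false → (H₀ - ∑ e, if u e = true then He e else 0).PosSemidef) ∧
      ¬ (H₀ - ∑ e, if cliqueVec T₁ e = true then He e else 0).PosSemidef ∧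
      ¬ (H₀ - ∑ e, if cliqueVec T₂ e = true then He e else 0).PosSemidef ∧
      ¬ (H₀ - ∑ e, if cliqueVec T₃ e = true then He e else 0).PosSemidef := by
  classical
  -- sizes and constants
  set K : ℕ := k.choose 2 with hKdef
  have hK3 : 3 ≤ K := by
    rw [hKdef]
    calc 3 = Nat.choose 3 2 := by decide
      _ ≤ k.choose 2 := Nat.choose_le_choose 2 hk
  have hK1 : 1 ≤ K := by omega
  have hKr : (3 : ℝ) ≤ K := by exact_mod_cast hK3
  have hcard : ∀ {T : Finset (Fin m)}, T.card = k → ((cliqueEdges T).card : ℝ) = K := by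
    intro T hT
    rw [cliqueEdges, Literature.Computability.Complexity.card_filter_cliqueVec T, hT]
  set η : ℝ := 1 / (8 * K) with hη
  set a₀ : ℝ := η * (K - 1 / 2) with ha₀
  have hη0 : 0 < η := by rw [hη]; positivity
  have hηK : η * K = 1 / 8 := by rw [hη]; field_simp
  -- indicator weights of the three cliques
  set d₁ : Edge m → ℝ := fun e => if cliqueVec T₁ e = true then 1 else 0 with hd₁
  set d₂ : Edge m → ℝ := fun e => if cliqueVec T₂ e = true then 1 else 0 with hd₂
  set d₃ : Edge m → ℝ := fun e => if cliqueVec T₃ e = true then 1 else 0 with hd₃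
  have hD : ∀ e, d₁ e + d₂ e + d₃ e ≤ 1 := by
    intro e
    have hmem : ∀ {T : Finset (Fin m)}, cliqueVec T e = true → e ∈ cliqueEdges T := fun h => by
      rw [cliqueEdges, Finset.mem_filter]; exact ⟨Finset.mem_univ _, h⟩
    rw [hd₁, hd₂, hd₃]
    dsimp only
    by_cases h1 : cliqueVec T₁ e = true
    · have h2 : ¬ cliqueVec T₂ e = true := fun h2 => Finset.disjoint_left.1 h12 (hmem h1) (hmem h2)
      have h3 : ¬ cliqueVec T₃ e = true := fun h3 => Finset.disjoint_left.1 h13 (hmem h1) (hmem h3)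
      simp [h1, h2, h3]
    · by_cases h2 : cliqueVec T₂ e = true
      · have h3 : ¬ cliqueVec T₃ e = true := fun h3 => Finset.disjoint_left.1 h23 (hmem h2) (hmem h3)
        simp [h1, h2, h3]
      · by_cases h3 : cliqueVec T₃ e = true <;> simp [h1, h2, h3]
  have hDnn : ∀ e, 0 ≤ d₁ e + d₂ e + d₃ e := by
    intro e; rw [hd₁, hd₂, hd₃]; dsimp only; positivity
  -- the pencil: `H₀ = a₀ I`, `H_e = −[[α_e + d₁ − d₂, d₃],[d₃, α_e − d₁ + d₂]]`, `α_e = 1 − η(d₁ + d₂ + d₃)`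
  set H₀ : Matrix (Fin 2) (Fin 2) ℝ := !![a₀, 0; 0, a₀] with hH₀
  set He : Edge m → Matrix (Fin 2) (Fin 2) ℝ := fun e =>
    !![-(1 - η * (d₁ e + d₂ e + d₃ e) + (d₁ e - d₂ e)), -d₃ e;
       -d₃ e, -(1 - η * (d₁ e + d₂ e + d₃ e) - (d₁ e - d₂ e))] with hHe
  -- symmetry
  have hherm : ∀ c : Edge m → Bool, (H₀ - ∑ e, if c e = true then He e else 0).IsHermitian := by
    intro c
    refine IsHermitian.ext fun i j => ?_
    rw [star_trivial, Matrix.sub_apply, Matrix.sub_apply, Matrix.sum_apply, Matrix.sum_apply]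
    have h0 : H₀ j i = H₀ i j := by rw [hH₀]; fin_cases i <;> fin_cases j <;> simp
    have h1 : ∀ e, (if c e = true then He e else 0) j i = (if c e = true then He e else 0) i j := by
      intro e
      split_ifs
      · rw [hHe]; fin_cases i <;> fin_cases j <;> simp
      · rfl
    rw [h0, Finset.sum_congr rfl fun e _ => h1 e]
  -- the quadratic form of the pencil at a graph `c`
  have hform : ∀ (c : Edge m → Bool) (y : Fin 2 → ℝ),
      y ⬝ᵥ ((H₀ - ∑ e, if c e = true then He e else 0) *ᵥ y) =
        (a₀ + ∑ e, if c e = true then (1 - η * (d₁ e + d₂ e + d₃ e)) else 0) * (y 0 ^ 2 + y 1 ^ 2) +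
        (∑ e, if c e = true then (d₁ e - d₂ e) else 0) * (y 0 ^ 2 - y 1 ^ 2) +
        (∑ e, if c e = true then d₃ e else 0) * (2 * (y 0 * y 1)) := by
    intro c y
    rw [dotProduct_pencil_mulVec, hH₀, dotProduct_mulVec_two]
    have hterm : ∀ e, (if c e = true then y ⬝ᵥ (He e *ᵥ y) else 0) =
        (if c e = true then (1 - η * (d₁ e + d₂ e + d₃ e)) else 0) * (-(y 0 ^ 2 + y 1 ^ 2)) +
        (if c e = true then (d₁ e - d₂ e) else 0) * (-(y 0 ^ 2 - y 1 ^ 2)) +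
        (if c e = true then d₃ e else 0) * (-(2 * (y 0 * y 1))) := by
      intro e
      split_ifs
      · rw [hHe]; dsimp only; rw [dotProduct_mulVec_two]; ring
      · ring
    rw [Finset.sum_congr rfl fun e _ => hterm e, Finset.sum_add_distrib, Finset.sum_add_distrib,
      ← Finset.sum_mul, ← Finset.sum_mul, ← Finset.sum_mul]
    ring
  -- indicator sums at the three bare cliques
  have hind : ∀ {T T' : Finset (Fin m)} (d : Edge m → ℝ), d = (fun e => if cliqueVec T' e = true then (1 : ℝ) else 0) →
      (∑ e, if cliqueVec T e = true then d e else 0) =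
        ∑ e, (if cliqueVec T e = true then (if cliqueVec T' e = true then (1 : ℝ) else 0) else 0) := by
    intro T T' d hd; rw [hd]
  have hd11 : (∑ e, if cliqueVec T₁ e = true then d₁ e else 0) = K := by
    rw [hind d₁ hd₁, sum_ite_ite_cliqueVec_self, hcard hT₁]
  have hd12 : (∑ e, if cliqueVec T₁ e = true then d₂ e else 0) = 0 := by
    rw [hind d₂ hd₂, sum_ite_ite_cliqueVec_disjoint h12]
  have hd13 : (∑ e, if cliqueVec T₁ e = true then d₃ e else 0) = 0 := by
    rw [hind d₃ hd₃, sum_ite_ite_cliqueVec_disjoint h13]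
  have hd21 : (∑ e, if cliqueVec T₂ e = true then d₁ e else 0) = 0 := by
    rw [hind d₁ hd₁, sum_ite_ite_cliqueVec_disjoint h12.symm]
  have hd22 : (∑ e, if cliqueVec T₂ e = true then d₂ e else 0) = K := by
    rw [hind d₂ hd₂, sum_ite_ite_cliqueVec_self, hcard hT₂]
  have hd23 : (∑ e, if cliqueVec T₂ e = true then d₃ e else 0) = 0 := by
    rw [hind d₃ hd₃, sum_ite_ite_cliqueVec_disjoint h23]
  have hd31 : (∑ e, if cliqueVec T₃ e = true then d₁ e else 0) = 0 := by
    rw [hind d₁ hd₁, sum_ite_ite_cliqueVec_disjoint h13.symm]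
  have hd32 : (∑ e, if cliqueVec T₃ e = true then d₂ e else 0) = 0 := by
    rw [hind d₂ hd₂, sum_ite_ite_cliqueVec_disjoint h23.symm]
  have hd33 : (∑ e, if cliqueVec T₃ e = true then d₃ e else 0) = K := by
    rw [hind d₃ hd₃, sum_ite_ite_cliqueVec_self, hcard hT₃]
  -- the three coefficients at a bare clique `T` of size `k`, in terms of the indicator sums
  have hS1 : ∀ T : Finset (Fin m), T.card = k →
      (∑ e, if cliqueVec T e = true then (1 - η * (d₁ e + d₂ e + d₃ e)) else 0) =
        K - η * ((∑ e, if cliqueVec T e = true then d₁ e else 0) + (∑ e, if cliqueVec T e = true then d₂ e else 0) +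
          ∑ e, if cliqueVec T e = true then d₃ e else 0) := by
    intro T hT
    have hK' : (∑ e, if cliqueVec T e = true then (1 : ℝ) else 0) = K := by
      rw [sum_ite_cliqueVec_eq_choose, hT]
    rw [← hK', mul_add, mul_add, Finset.mul_sum, Finset.mul_sum, Finset.mul_sum, ← Finset.sum_add_distrib,
      ← Finset.sum_add_distrib, ← Finset.sum_sub_distrib]
    exact Finset.sum_congr rfl fun e _ => by split_ifs <;> ring
  have hS2 : ∀ T : Finset (Fin m),
      (∑ e, if cliqueVec T e = true then (d₁ e - d₂ e) else 0) =
        (∑ e, if cliqueVec T e = true then d₁ e else 0) - ∑ e, if cliqueVec T e = true then d₂ e else 0 := by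
    intro T
    rw [← Finset.sum_sub_distrib]
    exact Finset.sum_congr rfl fun e _ => by split_ifs <;> ring
  have hS3 : ∀ T : Finset (Fin m),
      (∑ e, if cliqueVec T e = true then d₃ e else 0) = ∑ e, if cliqueVec T e = true then d₃ e else 0 := fun T => rfl
  refine ⟨H₀, He, fun u hu => ?_, fun hpsd => ?_, fun hpsd => ?_, fun hpsd => ?_⟩
  · -- validity at a clique-free graph
    -- the three edge counts
    have hn : ∀ {T : Finset (Fin m)} (d : Edge m → ℝ), T.card = k →
        d = (fun e => if cliqueVec T e = true then (1 : ℝ) else 0) →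
        ∃ n : ℕ, n + 1 ≤ K ∧ (∑ e, if u e = true then d e else 0) = n := by
      intro T d hT hd
      refine ⟨((Finset.univ : Finset (Edge m)).filter fun e => u e = true ∧ cliqueVec T e = true).card, ?_, ?_⟩
      · have h := sum_ite_ite_le_of_cliqueFree hT hu
        rw [hcard hT] at h
        have hs : (∑ f, (if u f = true then (if cliqueVec T f = true then (1 : ℝ) else 0) else 0)) =
            (((Finset.univ : Finset (Edge m)).filter fun e => u e = true ∧ cliqueVec T e = true).card : ℝ) := by
          rw [Finset.card_filter]
          push_cast
          exact Finset.sum_congr rfl fun f _ => by by_cases h1 : u f = true <;> by_cases h2 : cliqueVec T f = true <;> simp [h1, h2]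
        rw [hs] at h
        exact_mod_cast h
      · rw [hd, Finset.card_filter]
        push_cast
        exact Finset.sum_congr rfl fun f _ => by by_cases h1 : u f = true <;> by_cases h2 : cliqueVec T f = true <;> simp [h1, h2]
    obtain ⟨n₁, hn₁, hs₁⟩ := hn d₁ hT₁ hd₁
    obtain ⟨n₂, hn₂, hs₂⟩ := hn d₂ hT₂ hd₂
    obtain ⟨n₃, hn₃, hs₃⟩ := hn d₃ hT₃ hd₃
    -- the coefficients of the form
    have hB₁ : (∑ e, if u e = true then (d₁ e - d₂ e) else 0) = (n₁ : ℝ) - n₂ := by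
      rw [← hs₁, ← hs₂, ← Finset.sum_sub_distrib]
      exact Finset.sum_congr rfl fun e _ => by split_ifs <;> ring
    have hB₂ : (∑ e, if u e = true then d₃ e else 0) = (n₃ : ℝ) := hs₃
    have hA : (1 / (8 * K) : ℝ) * (K - 1 / 2) + (1 - 1 / (8 * K)) * (n₁ + n₂ + n₃) ≤
        a₀ + ∑ e, if u e = true then (1 - η * (d₁ e + d₂ e + d₃ e)) else 0 := by
      have hsplit : (∑ e, if u e = true then (1 - η * (d₁ e + d₂ e + d₃ e)) else 0) =
          (∑ e, if u e = true then (1 - (d₁ e + d₂ e + d₃ e)) else 0) +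
            (1 - η) * ((∑ e, if u e = true then d₁ e else 0) + (∑ e, if u e = true then d₂ e else 0) +
              ∑ e, if u e = true then d₃ e else 0) := by
        rw [← Finset.sum_add_distrib, ← Finset.sum_add_distrib, Finset.mul_sum, ← Finset.sum_add_distrib]
        exact Finset.sum_congr rfl fun e _ => by split_ifs <;> ring
      have hnn : 0 ≤ ∑ e, if u e = true then (1 - (d₁ e + d₂ e + d₃ e)) else 0 :=
        Finset.sum_nonneg fun e _ => by split_ifs <;> [linarith [hD e]; exact le_rfl]
      rw [hsplit, hs₁, hs₂, hs₃, ha₀, hη]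
      linarith
    obtain ⟨hA0, hsq⟩ := soc_core_ineq hK1 hn₁ hn₂ hn₃ hA
    refine PosSemidef.of_dotProduct_mulVec_nonneg (hherm u) fun y => ?_
    rw [star_trivial, hform u y, hB₁, hB₂]
    exact soc_form_nonneg hA0 hsq y
  · -- `T₁`: direction `(0,1)`
    have h := hpsd.dotProduct_mulVec_nonneg ![0, 1]
    rw [star_trivial, hform, hS1 T₁ hT₁, hS2 T₁, hS3 T₁, hd11, hd12, hd13] at h
    simp only [Matrix.cons_val_zero, Matrix.cons_val_one] at h
    rw [ha₀] at h
    nlinarith [hηK, hη0]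
  · -- `T₂`: direction `(1,0)`
    have h := hpsd.dotProduct_mulVec_nonneg ![1, 0]
    rw [star_trivial, hform, hS1 T₂ hT₂, hS2 T₂, hS3 T₂, hd21, hd22, hd23] at h
    simp only [Matrix.cons_val_zero, Matrix.cons_val_one] at h
    rw [ha₀] at h
    nlinarith [hηK, hη0]
  · -- `T₃`: direction `(1,−1)`
    have h := hpsd.dotProduct_mulVec_nonneg ![1, -1]
    rw [star_trivial, hform, hS1 T₃ hT₃, hS2 T₃, hS3 T₃, hd31, hd32, hd33] at h
    simp only [Matrix.cons_val_zero, Matrix.cons_val_one] at h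
    rw [ha₀] at h
    nlinarith [hηK, hη0]

/-- **One `2 × 2` valid pencil excludes three bare cliques** (registered form of `soc_pencil_excludes_three`). [new] -/
theorem soc_pencil_excludes_three_cliques : ∀ {m k : ℕ}, 3 ≤ k → ∀ {T₁ T₂ T₃ : Finset (Fin m)}, T₁.card = k → T₂.card = k → T₃.card = k → Disjoint (cliqueEdges T₁) (cliqueEdges T₂) → Disjoint (cliqueEdges T₁) (cliqueEdges T₃) → Disjoint (cliqueEdges T₂) (cliqueEdges T₃) → ∃ (H₀ : Matrix (Fin 2) (Fin 2) ℝ) (He : Edge m → Matrix (Fin 2) (Fin 2) ℝ), (∀ u : Edge m → Bool, cliqueFn m k u = false → (H₀ - ∑ e, if u e = true then He e else 0).PosSemidef) ∧ ¬ (H₀ - ∑ e, if cliqueVec T₁ e = true then He e else 0).PosSemidef ∧ ¬ (H₀ - ∑ e, if cliqueVec T₂ e = true then He e else 0).PosSemidef ∧ ¬ (H₀ - ∑ e, if cliqueVec T₃ e = true then He e else 0).PosSemidef :=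
  fun hk _ _ _ h₁ h₂ h₃ h12 h13 h23 => soc_pencil_excludes_three hk h₁ h₂ h₃ h12 h13 h23

end

end Summit.PneNP.PneNP.Theorems
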